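import Mathlib
import HarnessLib
import Summits.Ventures.LatticeQCDFlow.Scoring.ChainSampleQuantileCLT
import Summits.Ventures.LatticeQCDFlow.Scoring.AsymptoticCoverage
import Summits.Ventures.LatticeQCDFlow.Scoring.AgreementTestPower

/-!
# A-vs-B for a PERCENTILE COLUMN computed from two independent MARKOV-CHAIN runs: the
# agreement criterion `|q̂^A_n − q̂^B_{mₙ}| ≤ z·√(V̂^A_n + V̂^B_{mₙ})` has asymptotically its nominal
# coverage `N(0,1)([−z, z])` when the two stationary laws share the `u`-quantile (each run's printed
# squared standard error consistent for its own `σ_q²/(n f²)`), and POWER tending to one when the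
# two stationary `u`-quantiles differ

HONEST FRAMING: exact (Metropolis-corrected) sampling algorithms for lattice gauge theory;
figures of merit are autocorrelation/cost numbers at stated couplings and volumes; no
continuum-physics claim.

Venture `LatticeQCDFlow` (cell pub-lqcd), topic `Scoring`; FANOUT row 4 (`s0-u1-b`, rung S0-B:
two independent implementations A and B of one card, agreement "within `1σ_comb` at every β").
Row 4's `Scoring/QuantileAgreement` (pending) treats a quantile column of two iid output
streams; the two arms are exact Markov-chain samplers.  This file is the chain version, a direct
composition of three tree results: the sample-quantile CLT along a chain in distribution
(`Scoring/ChainSampleQuantileCLT.sampleQuantile_clt_of_edf_clt`: `√n (q̂_n − q) ⇒ Y/f`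
from an EDF CLT at `q`, which row 8's `markovChain_clt` provides for every Doeblin chain from any
start — `chain_sampleQuantile_clt`), the law `Y/f ∼ N(0, v/f²)`
(`ProbabilityTheory.gaussianReal_div_const`), and row 4's abstract coverage theorem
`Scoring/AsymptoticCoverage.twoSample_agreement_coverage` (two independent codes, one-code CLTs,
error bars consistent in probability, arm B read along any `mₙ → ∞`).
**`chain_quantile_agreement_coverage`**: two Markov kernels `κ_A`, `κ_B` (any state spaces) with
invariant laws `π_A`, `π_B`, minorisations `κ_X(x, ·) ≥ ε_X π_X`, statistics `O_A`, `O_B` whose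
stationary distribution functions share the `u`-quantile `q` (`F_A(q) = u = F_B(q)`) with
derivatives `f_A, f_B > 0` there; EDF CLTs at `q` along each chain with limits `Y_A ∼ N(0, v_A)`,
`Y_B ∼ N(0, v_B)` (`v_A, v_B ≠ 0`); printed squared standard errors with `n·V̂^X_n → v_X/f_X²` in
probability; then for every `z`, from ANY initial laws,
`(P_A ⊗ P_B)(|q̂^A_n − q̂^B_{mₙ}| ≤ z·√(V̂^A_n + V̂^B_{mₙ})) → N(0,1)([−z, z])`.
NEW WORK of the cell (composition); no definition is introduced.

POWER (**`chain_quantile_agreement_power`**): if instead the two stationary `u`-quantiles differ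
(`q_A ≠ q_B`, each arm's EDF CLT at its own quantile, error bars nonnegative and consistent), the
criterion holds with probability tending to ZERO — row 4's abstract
`Scoring/AgreementTestPower.twoSample_agreement_power` fed the same way.

## Content

* `hasLaw_div_const_gaussian` — `Y ∼ N(0, v)` ⇒ `Y/f ∼ N(0, (v/f²))` in the `toNNReal` form the
  coverage theorem consumes;
* **`chain_quantile_agreement_coverage`**, **`chain_quantile_agreement_power`**.

NOT CLAIMED: a consistent estimator of the MCMC quantile standard error (taken as the hypothesis
`n·V̂_n → σ_q²/f²`; its ingredients `1/f` — `Scoring/ChainQuantileSpacing` — and `σ_q²` — batch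
means of the indicator at the estimated quantile — are separate); power against a quantile
discrepancy; degenerate variances.
-/

noncomputable section

namespace Summit.Ventures.LatticeQCDFlow.Scoring.GlivenkoCantelli

open MeasureTheory ProbabilityTheory Finset Filter Function
open scoped Topology ENNReal NNReal

/-- `Y ∼ N(0, v)`, `f` real ⇒ `Y/f ∼ N(0, (v/f²).toNNReal)`. [folklore] (Mathlib's
`gaussianReal_div_const`, variance rewritten) -/
theorem hasLaw_div_const_gaussian {Ω' : Type*} [MeasurableSpace Ω'] {P' : Measure Ω'}
    {Y : Ω' → ℝ} {v : ℝ≥0} (hY : HasLaw Y (gaussianReal 0 v) P') (f : ℝ) :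
    HasLaw (fun ω => Y ω / f) (gaussianReal 0 (((v : ℝ) / f ^ 2).toNNReal)) P' := by
  have h := gaussianReal_div_const hY f
  have e1 : (0 : ℝ) / f = 0 := zero_div _
  have e2 : v / NNReal.mk (f ^ 2) (sq_nonneg _) = ((v : ℝ) / f ^ 2).toNNReal := by
    rw [Real.toNNReal_div' (sq_nonneg _), Real.toNNReal_coe]
    congr 1
    exact NNReal.eq (by rw [Real.coe_toNNReal _ (sq_nonneg f)]; rfl)
  rwa [e1, e2] at h

variable {ΩA : Type*} [MeasurableSpace ΩA] {κA : Kernel ΩA ΩA} [IsMarkovKernel κA]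
  {μA : Measure ΩA} [IsProbabilityMeasure μA] {πA : Measure ΩA} [IsProbabilityMeasure πA]
variable {ΩB : Type*} [MeasurableSpace ΩB] {κB : Kernel ΩB ΩB} [IsMarkovKernel κB]
  {μB : Measure ΩB} [IsProbabilityMeasure μB] {πB : Measure ΩB} [IsProbabilityMeasure πB]
variable {Ω' : Type*} [MeasurableSpace Ω'] {P' : Measure Ω'} [IsProbabilityMeasure P']
  {YA YB Z : Ω' → ℝ}

/-- **THE A-VS-B PERCENTILE CRITERION FOR TWO MARKOV-CHAIN RUNS HAS ITS NOMINAL ASYMPTOTIC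
COVERAGE.**  Arms A and B: Markov kernels with invariant laws `π_A`, `π_B` and minorisations
`κ_X(x, ·) ≥ ε_X π_X` (`ε_X > 0`), measurable statistics `O_A`, `O_B` with `F_A(q) = u = F_B(q)`,
`u ∈ (0,1)`, derivatives `f_A, f_B > 0` at `q`; along each chain (trajectory law from ANY initial
law) an EDF CLT at `q`, `(√n)⁻¹ Σ_{i<n} (1{O_X(X_i) ≤ q} − u) ⇒ Y_X ∼ N(0, v_X)`, `v_X ≠ 0`
(row 8's `markovChain_clt` supplies it, cf. `chain_sampleQuantile_clt`); printed squared standard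
errors `V̂^X_n` (measurable) with `n·V̂^X_n → v_X/f_X²` in probability; arm B read along
`mₙ → ∞`; `Z ∼ N(0, 1)`.  Then for every `z`, with `q̂^X_n` the empirical `u`-quantile of the first
`n` states of arm `X`:
`(P_A ⊗ P_B)(|(q̂^A_n − q̂^B_{mₙ})/√(V̂^A_n + V̂^B_{mₙ})| ≤ z) → N(0,1)([−z, z])`. [ours] -/
theorem chain_quantile_agreement_coverage
    (hπA : Kernel.Invariant κA πA) {εA : ℝ≥0∞}
    (hminA : ∀ x {B : Set ΩA}, MeasurableSet B → εA * πA B ≤ κA x B) (hεA0 : 0 < εA)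
    {OA : ΩA → ℝ} (hOA : Measurable OA)
    (hπB : Kernel.Invariant κB πB) {εB : ℝ≥0∞}
    (hminB : ∀ x {B : Set ΩB}, MeasurableSet B → εB * πB B ≤ κB x B) (hεB0 : 0 < εB)
    {OB : ΩB → ℝ} (hOB : Measurable OB)
    {u q fA fB : ℝ} (hu0 : 0 < u) (hu1 : u < 1)
    (hFqA : cdf (πA.map OA) q = u) (hderA : HasDerivAt (cdf (πA.map OA)) fA q) (hfA : 0 < fA)
    (hFqB : cdf (πB.map OB) q = u) (hderB : HasDerivAt (cdf (πB.map OB)) fB q) (hfB : 0 < fB)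
    {vA vB : ℝ≥0} (hvA : vA ≠ 0) (hvB : vB ≠ 0)
    (hYA : HasLaw YA (gaussianReal 0 vA) P') (hYB : HasLaw YB (gaussianReal 0 vB) P')
    [IsProbabilityMeasure (Kernel.trajMeasure (X := fun _ : ℕ => ΩA) μA
          (fun m : ℕ => κA.comap
            (fun y : (i : ↥(Finset.Iic m)) → ΩA => y ⟨m, Finset.mem_Iic.2 le_rfl⟩)
            (measurable_pi_apply _)))]
    [IsProbabilityMeasure (Kernel.trajMeasure (X := fun _ : ℕ => ΩB) μB
          (fun m : ℕ => κB.comap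
            (fun y : (i : ↥(Finset.Iic m)) → ΩB => y ⟨m, Finset.mem_Iic.2 le_rfl⟩)
            (measurable_pi_apply _)))]
    (hcltA : TendstoInDistribution (fun (N : ℕ) (ξ : ℕ → ΩA) =>
        (Real.sqrt N)⁻¹ * ∑ i ∈ range N, ((Set.Iic q).indicator (1 : ℝ → ℝ) (OA (ξ i)) - u))
      atTop YA (fun _ => Kernel.trajMeasure (X := fun _ : ℕ => ΩA) μA
          (fun m : ℕ => κA.comap
            (fun y : (i : ↥(Finset.Iic m)) → ΩA => y ⟨m, Finset.mem_Iic.2 le_rfl⟩)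
            (measurable_pi_apply _))) P')
    (hcltB : TendstoInDistribution (fun (N : ℕ) (ξ : ℕ → ΩB) =>
        (Real.sqrt N)⁻¹ * ∑ i ∈ range N, ((Set.Iic q).indicator (1 : ℝ → ℝ) (OB (ξ i)) - u))
      atTop YB (fun _ => Kernel.trajMeasure (X := fun _ : ℕ => ΩB) μB
          (fun m : ℕ => κB.comap
            (fun y : (i : ↥(Finset.Iic m)) → ΩB => y ⟨m, Finset.mem_Iic.2 le_rfl⟩)
            (measurable_pi_apply _))) P')
    {VA : ℕ → (ℕ → ΩA) → ℝ} {VB : ℕ → (ℕ → ΩB) → ℝ}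
    (hVAm : ∀ n, Measurable (VA n)) (hVBm : ∀ n, Measurable (VB n))
    (hVA : TendstoInMeasure (Kernel.trajMeasure (X := fun _ : ℕ => ΩA) μA
          (fun m : ℕ => κA.comap
            (fun y : (i : ↥(Finset.Iic m)) → ΩA => y ⟨m, Finset.mem_Iic.2 le_rfl⟩)
            (measurable_pi_apply _)))
      (fun (n : ℕ) ξ => (n : ℝ) * VA n ξ) atTop fun _ => (vA : ℝ) / fA ^ 2)
    (hVB : TendstoInMeasure (Kernel.trajMeasure (X := fun _ : ℕ => ΩB) μB
          (fun m : ℕ => κB.comap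
            (fun y : (i : ↥(Finset.Iic m)) → ΩB => y ⟨m, Finset.mem_Iic.2 le_rfl⟩)
            (measurable_pi_apply _)))
      (fun (n : ℕ) ξ => (n : ℝ) * VB n ξ) atTop fun _ => (vB : ℝ) / fB ^ 2)
    {m : ℕ → ℕ} (hm : Tendsto m atTop atTop) (hZ : HasLaw Z (gaussianReal 0 1) P') (z : ℝ) :
    Tendsto (fun n => ((Kernel.trajMeasure (X := fun _ : ℕ => ΩA) μA
          (fun m : ℕ => κA.comap
            (fun y : (i : ↥(Finset.Iic m)) → ΩA => y ⟨m, Finset.mem_Iic.2 le_rfl⟩)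
            (measurable_pi_apply _))).prod
        (Kernel.trajMeasure (X := fun _ : ℕ => ΩB) μB
          (fun m : ℕ => κB.comap
            (fun y : (i : ↥(Finset.Iic m)) → ΩB => y ⟨m, Finset.mem_Iic.2 le_rfl⟩)
            (measurable_pi_apply _)))).real
        {ω : (ℕ → ΩA) × (ℕ → ΩB) |
          |(sInf {y | u ≤ (∑ i ∈ range n, (Set.Iic y).indicator (1 : ℝ → ℝ) (OA (ω.1 i))) / n}
            - sInf {y | u ≤ (∑ i ∈ range (m n),
                (Set.Iic y).indicator (1 : ℝ → ℝ) (OB (ω.2 i))) / (m n)})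
            / Real.sqrt (VA n ω.1 + VB (m n) ω.2)| ≤ z})
      atTop (𝓝 ((gaussianReal 0 1).real (Set.Icc (-z) z))) := by
  have hA := sampleQuantile_clt_of_edf_clt (μ₀ := μA) hπA hminA hεA0 hOA hu0 hu1 hFqA hderA hfA
    hvA hYA hcltA
  have hB := sampleQuantile_clt_of_edf_clt (μ₀ := μB) hπB hminB hεB0 hOB hu0 hu1 hFqB hderB hfB
    hvB hYB hcltB
  have hvA' : 0 < (vA : ℝ) := NNReal.coe_pos.2 (pos_iff_ne_zero.2 hvA)
  have hvB' : 0 < (vB : ℝ) := NNReal.coe_pos.2 (pos_iff_ne_zero.2 hvB)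
  have hsA : 0 < (vA : ℝ) / fA ^ 2 := by positivity
  have hsB : 0 < (vB : ℝ) / fB ^ 2 := by positivity
  have hZA := hasLaw_div_const_gaussian hYA fA
  have hZB := hasLaw_div_const_gaussian hYB fB
  exact CardConsistency.twoSample_agreement_coverage hsA hsB
    (fun n => measurable_edfQuantile hOA hu0 hu1 n) hVAm
    (fun n => measurable_edfQuantile hOB hu0 hu1 n) hVBm hA hZA hB hZB hVA hVB hm hZ z

/-- **THE A-VS-B PERCENTILE CRITERION HAS POWER TENDING TO ONE AGAINST DIFFERENT STATIONARY
QUANTILES.**  Arms A and B: Markov kernels with invariant laws `π_A`, `π_B`, minorisations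
`κ_X(x, ·) ≥ ε_X π_X` (`ε_X > 0`), measurable statistics with `F_A(q_A) = u = F_B(q_B)`, `u ∈ (0,1)`,
derivatives `f_A, f_B > 0` at `q_A`, `q_B`, and `q_A ≠ q_B`; EDF CLTs at the respective quantiles
along each chain (any start) with limits `Y_X ∼ N(0, v_X)`, `v_X ≠ 0`; printed squared standard
errors `V̂^X_n ≥ 0` with `n·V̂^X_n → v_X/f_X²` in probability; `mₙ → ∞`.  Then for every `z`:
`(P_A ⊗ P_B)(|(q̂^A_n − q̂^B_{mₙ})/√(V̂^A_n + V̂^B_{mₙ})| ≤ z) → 0`. [ours] -/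
theorem chain_quantile_agreement_power
    (hπA : Kernel.Invariant κA πA) {εA : ℝ≥0∞}
    (hminA : ∀ x {B : Set ΩA}, MeasurableSet B → εA * πA B ≤ κA x B) (hεA0 : 0 < εA)
    {OA : ΩA → ℝ} (hOA : Measurable OA)
    (hπB : Kernel.Invariant κB πB) {εB : ℝ≥0∞}
    (hminB : ∀ x {B : Set ΩB}, MeasurableSet B → εB * πB B ≤ κB x B) (hεB0 : 0 < εB)
    {OB : ΩB → ℝ} (hOB : Measurable OB)
    {u qA qB fA fB : ℝ} (hu0 : 0 < u) (hu1 : u < 1) (hq : qA ≠ qB)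
    (hFqA : cdf (πA.map OA) qA = u) (hderA : HasDerivAt (cdf (πA.map OA)) fA qA) (hfA : 0 < fA)
    (hFqB : cdf (πB.map OB) qB = u) (hderB : HasDerivAt (cdf (πB.map OB)) fB qB) (hfB : 0 < fB)
    {vA vB : ℝ≥0} (hvA : vA ≠ 0) (hvB : vB ≠ 0)
    (hYA : HasLaw YA (gaussianReal 0 vA) P') (hYB : HasLaw YB (gaussianReal 0 vB) P')
    [IsProbabilityMeasure (Kernel.trajMeasure (X := fun _ : ℕ => ΩA) μA
          (fun m : ℕ => κA.comap
            (fun y : (i : ↥(Finset.Iic m)) → ΩA => y ⟨m, Finset.mem_Iic.2 le_rfl⟩)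
            (measurable_pi_apply _)))]
    [IsProbabilityMeasure (Kernel.trajMeasure (X := fun _ : ℕ => ΩB) μB
          (fun m : ℕ => κB.comap
            (fun y : (i : ↥(Finset.Iic m)) → ΩB => y ⟨m, Finset.mem_Iic.2 le_rfl⟩)
            (measurable_pi_apply _)))]
    (hcltA : TendstoInDistribution (fun (N : ℕ) (ξ : ℕ → ΩA) =>
        (Real.sqrt N)⁻¹ * ∑ i ∈ range N, ((Set.Iic qA).indicator (1 : ℝ → ℝ) (OA (ξ i)) - u))
      atTop YA (fun _ => Kernel.trajMeasure (X := fun _ : ℕ => ΩA) μA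
          (fun m : ℕ => κA.comap
            (fun y : (i : ↥(Finset.Iic m)) → ΩA => y ⟨m, Finset.mem_Iic.2 le_rfl⟩)
            (measurable_pi_apply _))) P')
    (hcltB : TendstoInDistribution (fun (N : ℕ) (ξ : ℕ → ΩB) =>
        (Real.sqrt N)⁻¹ * ∑ i ∈ range N, ((Set.Iic qB).indicator (1 : ℝ → ℝ) (OB (ξ i)) - u))
      atTop YB (fun _ => Kernel.trajMeasure (X := fun _ : ℕ => ΩB) μB
          (fun m : ℕ => κB.comap
            (fun y : (i : ↥(Finset.Iic m)) → ΩB => y ⟨m, Finset.mem_Iic.2 le_rfl⟩)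
            (measurable_pi_apply _))) P')
    {VA : ℕ → (ℕ → ΩA) → ℝ} {VB : ℕ → (ℕ → ΩB) → ℝ}
    (hVA0 : ∀ n ξ, 0 ≤ VA n ξ) (hVB0 : ∀ n ξ, 0 ≤ VB n ξ)
    (hVA : TendstoInMeasure (Kernel.trajMeasure (X := fun _ : ℕ => ΩA) μA
          (fun m : ℕ => κA.comap
            (fun y : (i : ↥(Finset.Iic m)) → ΩA => y ⟨m, Finset.mem_Iic.2 le_rfl⟩)
            (measurable_pi_apply _)))
      (fun (n : ℕ) ξ => (n : ℝ) * VA n ξ) atTop fun _ => (vA : ℝ) / fA ^ 2)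
    (hVB : TendstoInMeasure (Kernel.trajMeasure (X := fun _ : ℕ => ΩB) μB
          (fun m : ℕ => κB.comap
            (fun y : (i : ↥(Finset.Iic m)) → ΩB => y ⟨m, Finset.mem_Iic.2 le_rfl⟩)
            (measurable_pi_apply _)))
      (fun (n : ℕ) ξ => (n : ℝ) * VB n ξ) atTop fun _ => (vB : ℝ) / fB ^ 2)
    {m : ℕ → ℕ} (hm : Tendsto m atTop atTop) (z : ℝ) :
    Tendsto (fun n => ((Kernel.trajMeasure (X := fun _ : ℕ => ΩA) μA
          (fun m : ℕ => κA.comap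
            (fun y : (i : ↥(Finset.Iic m)) → ΩA => y ⟨m, Finset.mem_Iic.2 le_rfl⟩)
            (measurable_pi_apply _))).prod
        (Kernel.trajMeasure (X := fun _ : ℕ => ΩB) μB
          (fun m : ℕ => κB.comap
            (fun y : (i : ↥(Finset.Iic m)) → ΩB => y ⟨m, Finset.mem_Iic.2 le_rfl⟩)
            (measurable_pi_apply _)))).real
        {ω : (ℕ → ΩA) × (ℕ → ΩB) |
          |(sInf {y | u ≤ (∑ i ∈ range n, (Set.Iic y).indicator (1 : ℝ → ℝ) (OA (ω.1 i))) / n}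
            - sInf {y | u ≤ (∑ i ∈ range (m n),
                (Set.Iic y).indicator (1 : ℝ → ℝ) (OB (ω.2 i))) / (m n)})
            / Real.sqrt (VA n ω.1 + VB (m n) ω.2)| ≤ z})
      atTop (𝓝 0) := by
  have hA := sampleQuantile_clt_of_edf_clt (μ₀ := μA) hπA hminA hεA0 hOA hu0 hu1 hFqA hderA hfA
    hvA hYA hcltA
  have hB := sampleQuantile_clt_of_edf_clt (μ₀ := μB) hπB hminB hεB0 hOB hu0 hu1 hFqB hderB hfB
    hvB hYB hcltB
  have hvA' : 0 < (vA : ℝ) := NNReal.coe_pos.2 (pos_iff_ne_zero.2 hvA)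
  have hsA : 0 < (vA : ℝ) / fA ^ 2 := by positivity
  exact CardConsistency.twoSample_agreement_power hq hsA hVA0 hVB0 hA hB hVA hVB hm z

end Summit.Ventures.LatticeQCDFlow.Scoring.GlivenkoCantelli

end
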